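import Summits.CriticalPhenomena.CardyFormulaZ2.Theorems.CardySelfDualSegmentUniformMarginalityDefs

/-!
# The corner mirror `Ŝ_v` of the self-dual corner family (vocabulary + basic API)

Support file of line `Sketch` for the crux `UniformMarginality` (stmt-CriticalPhenomena-5472, route
`CardySelfDualSegment`), namespace `…Cruxes.UniformMarginality.HeatFlow`.  It introduces the ONE lattice
symmetry of every `M_t = cornerPercolation t` that FIXES a given corner `{E_v, N_v}` (idea card
`Cruxes/UniformMarginality/Ideas/and-or-mirror-stress.md`): the **corner mirror**

  `Ŝ_v ω = {cornerEdge (u, j) | cornerEdge (σ_v u, j) ∉ ω}`,  `σ_v u = (v₀ + v₁ − u₁, v₀ + v₁ − u₀)`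

— reflect the VERTEX owning an edge in the antidiagonal through `v`, keep the edge type (east ↦ east,
north ↦ north), complement the state.  On the coin space it is `(c, d)_u ↦ (¬ c, d)_{σ_v u}`
(`cornerMirror_cornerConfig`), a product of a vertex reindexing and an involutive block map fixing the
splitting bit, hence measure preserving for every `t` (`cornerPercolation_map_cornerMirror`); it is an
involution on lattice configurations, exchanges "switch `e` on" with "switch `σ_v e` off"
(`cornerMirror_insert`, `cornerMirror_diff_singleton`) and complements the two edges of the corner `v`
itself (`eastEdge_mem_cornerMirror_iff`, `northEdge_mem_cornerMirror_iff`).  The **mirror event**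
`mirrorEvent v A = {ω | Ŝ_v ω ∉ A}` of an increasing event is increasing.

These are the objects of the exact "λ⁺ = λ⁻" identity of the line (the Russo census
`∂_t P_t = ½ Σ_v E_t[(1 − 2c_v) 𝟙{N_v piv}]` is the antisymmetrisation under the corner mirrors of ONE
functional, `Π_v(A) = M_t{N_v pivotal for A with E_v closed}`), proved in the companion files
`…UniformMarginalityMirrorCensus.lean` / `…MirrorPivotal.lean`.
-/

noncomputable section

namespace Summit.CriticalPhenomena.CardyFormulaZ2.Cruxes.UniformMarginality.HeatFlow

open MeasureTheory Literature.Probability.Percolation Literature.Probability.LatticeModels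
  Literature.Probability.RandomPlanarGeometry

/-! ## §1 The antidiagonal reflection through a vertex -/

/-- The reflection of `ℤ²` in the antidiagonal through `v`: `u ↦ (v₀ + v₁ − u₁, v₀ + v₁ − u₀)`. -/
def antidiagReflect (v : Site 2) (u : Site 2) : Site 2 := ![v 0 + v 1 - u 1, v 0 + v 1 - u 0]

/-- First coordinate of the reflected vertex. -/
@[simp] theorem antidiagReflect_apply_zero (v u : Site 2) : antidiagReflect v u 0 = v 0 + v 1 - u 1 := rfl

/-- Second coordinate of the reflected vertex. -/
@[simp] theorem antidiagReflect_apply_one (v u : Site 2) : antidiagReflect v u 1 = v 0 + v 1 - u 0 := rfl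

/-- The reflection is an involution. -/
theorem antidiagReflect_antidiagReflect (v u : Site 2) : antidiagReflect v (antidiagReflect v u) = u := by
  ext i
  fin_cases i
  · simp only [Fin.zero_eta, antidiagReflect_apply_zero, antidiagReflect_apply_one]; ring
  · simp only [Fin.mk_one, antidiagReflect_apply_one, antidiagReflect_apply_zero]; ring

/-- The reflection is an involution (functional form). -/
theorem antidiagReflect_involutive (v : Site 2) : Function.Involutive (antidiagReflect v) :=
  antidiagReflect_antidiagReflect v

/-- The reflection fixes `v`. -/
@[simp] theorem antidiagReflect_self (v : Site 2) : antidiagReflect v v = v := by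
  ext i
  fin_cases i
  · simp only [Fin.zero_eta, antidiagReflect_apply_zero]; ring
  · simp only [Fin.mk_one, antidiagReflect_apply_one]; ring

/-- The reflection as a bijection of `ℤ²`. -/
def antidiagEquiv (v : Site 2) : Site 2 ≃ Site 2 :=
  Function.Involutive.toPerm (antidiagReflect v) (antidiagReflect_involutive v)

/-- `antidiagEquiv v` acts by `antidiagReflect v`. -/
@[simp] theorem antidiagEquiv_apply (v u : Site 2) : antidiagEquiv v u = antidiagReflect v u := rfl

/-! ## §2 The coin flip of a corner

The block map of the mirror on the two bits `(c, d)` of a vertex is `(¬ c, d)`; it is written out as the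
lambda `fun g j => if j = 0 then ¬ g 0 else g 1` (a map into `Fin 2 → Prop`, deliberately not a named
definition). -/

/-- The coin flip `(c, d) ↦ (¬ c, d)` is an involution of the four-point space. -/
theorem flipCoin_involutive :
    Function.Involutive (fun (g : Fin 2 → Prop) (j : Fin 2) => if j = 0 then ¬ g 0 else g 1) := by
  intro g
  funext j
  fin_cases j
  · simp only [Fin.zero_eta, Fin.isValue, ↓reduceIte]
    exact propext not_not
  · rfl

/-- The coin flip fixes the splitting bit. -/
theorem flipCoin_one (g : Fin 2 → Prop) :
    (fun (g : Fin 2 → Prop) (j : Fin 2) => if j = 0 then ¬ g 0 else g 1) g 1 = g 1 := rfl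

/-! ## §3 The corner mirror -/

/-- **The corner mirror `Ŝ_v`**: the edge `cornerEdge (u, j)` is open in `Ŝ_v ω` iff the edge of the
same type at the reflected vertex, `cornerEdge (σ_v u, j)`, is CLOSED in `ω`. -/
def cornerMirror (v : Site 2) (ω : BondConfig (Site 2)) : BondConfig (Site 2) :=
  edgeConfig {i | cornerEdge (antidiagReflect v i.1, i.2) ∉ ω}

/-- The state of a lattice edge in the mirrored configuration. -/
theorem cornerEdge_mem_cornerMirror_iff (v : Site 2) (ω : BondConfig (Site 2)) (u : Site 2) (j : Fin 2) :
    cornerEdge (u, j) ∈ cornerMirror v ω ↔ cornerEdge (antidiagReflect v u, j) ∉ ω := by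
  unfold cornerMirror
  rw [cornerEdge_mem_edgeConfig_iff]
  rfl

/-- Pair form of `cornerEdge_mem_cornerMirror_iff`. -/
theorem cornerEdge_mem_cornerMirror_iff' (v : Site 2) (ω : BondConfig (Site 2)) (i : Site 2 × Fin 2) :
    cornerEdge i ∈ cornerMirror v ω ↔ cornerEdge (antidiagReflect v i.1, i.2) ∉ ω :=
  cornerEdge_mem_cornerMirror_iff v ω i.1 i.2

/-- The mirrored configuration consists of lattice edges. -/
theorem cornerMirror_subset_edgeSet (v : Site 2) (ω : BondConfig (Site 2)) :
    cornerMirror v ω ⊆ (zdGraph 2).edgeSet :=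
  edgeConfig_subset_edgeSet _

/-- `eastEdge v = cornerEdge (v, 0)`. -/
theorem eastEdge_eq_cornerEdge (v : Site 2) : eastEdge v = cornerEdge (v, 0) := (cornerEdge_zero v).symm

/-- `northEdge v = cornerEdge (v, 1)`. -/
theorem northEdge_eq_cornerEdge (v : Site 2) : northEdge v = cornerEdge (v, 1) := (cornerEdge_one v).symm

/-- **The mirror complements the east edge of its own corner.** -/
theorem eastEdge_mem_cornerMirror_iff (v : Site 2) (ω : BondConfig (Site 2)) :
    eastEdge v ∈ cornerMirror v ω ↔ eastEdge v ∉ ω := by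
  rw [eastEdge_eq_cornerEdge, cornerEdge_mem_cornerMirror_iff, antidiagReflect_self]

/-- **The mirror complements the north edge of its own corner.** -/
theorem northEdge_mem_cornerMirror_iff (v : Site 2) (ω : BondConfig (Site 2)) :
    northEdge v ∈ cornerMirror v ω ↔ northEdge v ∉ ω := by
  rw [northEdge_eq_cornerEdge, cornerEdge_mem_cornerMirror_iff, antidiagReflect_self]

/-- **The mirror is an involution on lattice configurations.** -/
theorem cornerMirror_cornerMirror (v : Site 2) {ω : BondConfig (Site 2)} (hω : ω ⊆ (zdGraph 2).edgeSet) :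
    cornerMirror v (cornerMirror v ω) = ω := by
  refine eq_of_forall_cornerEdge_mem_iff (cornerMirror_subset_edgeSet v _) hω fun i => ?_
  obtain ⟨u, j⟩ := i
  rw [cornerEdge_mem_cornerMirror_iff, cornerEdge_mem_cornerMirror_iff, antidiagReflect_antidiagReflect,
    not_not]

/-- The mirror only reads lattice edges: `Ŝ_v (ω ∩ E(ℤ²)) = Ŝ_v ω`. -/
theorem cornerMirror_inter_edgeSet (v : Site 2) (ω : BondConfig (Site 2)) :
    cornerMirror v (ω ∩ (zdGraph 2).edgeSet) = cornerMirror v ω := by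
  refine eq_of_forall_cornerEdge_mem_iff (cornerMirror_subset_edgeSet v _) (cornerMirror_subset_edgeSet v _)
    fun i => ?_
  obtain ⟨u, j⟩ := i
  simp only [cornerEdge_mem_cornerMirror_iff, Set.mem_inter_iff,
    Literature.Probability.Percolation.cornerEdge_mem_edgeSet, and_true]

/-- The mirror is injective on lattice configurations. -/
theorem cornerMirror_injOn (v : Site 2) :
    Set.InjOn (cornerMirror v) {ω : BondConfig (Site 2) | ω ⊆ (zdGraph 2).edgeSet} := by
  intro ω hω ω' hω' h
  rw [← cornerMirror_cornerMirror v hω, ← cornerMirror_cornerMirror v hω', h]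

/-- **The mirror is measurable.** -/
theorem measurable_cornerMirror (v : Site 2) : Measurable (cornerMirror v) := by
  have h : Measurable fun ω : BondConfig (Site 2) =>
      ({i : Site 2 × Fin 2 | cornerEdge (antidiagReflect v i.1, i.2) ∉ ω} : Set (Site 2 × Fin 2)) :=
    measurable_set_iff.2 fun i => (measurable_set_mem _).not
  exact measurable_edgeConfig.comp h

/-- **The mirror is antitone**: opening edges of `ω` closes edges of `Ŝ_v ω`. -/
theorem cornerMirror_antitone (v : Site 2) : Antitone (cornerMirror v) := by
  intro ω ω' h e he
  obtain ⟨i, hi, rfl⟩ := he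
  exact ⟨i, fun h' => hi (h h'), rfl⟩

/-- **Switching an edge ON before mirroring = switching its mirror image OFF after mirroring**
(exact, for every configuration). -/
theorem cornerMirror_insert (v : Site 2) (ω : BondConfig (Site 2)) (u : Site 2) (j : Fin 2) :
    cornerMirror v (insert (cornerEdge (u, j)) ω) =
      cornerMirror v ω \ {cornerEdge (antidiagReflect v u, j)} := by
  refine eq_of_forall_cornerEdge_mem_iff (cornerMirror_subset_edgeSet v _)
    ((cornerMirror_subset_edgeSet v _).trans' Set.sdiff_subset) fun i => ?_
  obtain ⟨w, k⟩ := i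
  rw [Set.mem_sdiff, Set.mem_singleton_iff, cornerEdge_mem_cornerMirror_iff,
    cornerEdge_mem_cornerMirror_iff, Set.mem_insert_iff, not_or, cornerEdge_injective.eq_iff,
    cornerEdge_injective.eq_iff, Prod.mk.injEq, Prod.mk.injEq]
  constructor
  · rintro ⟨h1, h2⟩
    refine ⟨h2, fun ⟨h3, h4⟩ => h1 ⟨?_, h4⟩⟩
    rw [h3, antidiagReflect_antidiagReflect]
  · rintro ⟨h2, h1⟩
    refine ⟨fun ⟨h3, h4⟩ => h1 ⟨?_, h4⟩, h2⟩
    rw [← h3, antidiagReflect_antidiagReflect]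

/-- **Switching an edge OFF before mirroring = switching its mirror image ON after mirroring**
(exact, for every configuration). -/
theorem cornerMirror_diff_singleton (v : Site 2) (ω : BondConfig (Site 2)) (u : Site 2) (j : Fin 2) :
    cornerMirror v (ω \ {cornerEdge (u, j)}) =
      insert (cornerEdge (antidiagReflect v u, j)) (cornerMirror v ω) := by
  refine eq_of_forall_cornerEdge_mem_iff (cornerMirror_subset_edgeSet v _)
    (Set.insert_subset (Literature.Probability.Percolation.cornerEdge_mem_edgeSet _)
      (cornerMirror_subset_edgeSet v _)) fun i => ?_
  obtain ⟨w, k⟩ := i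
  rw [Set.mem_insert_iff, cornerEdge_mem_cornerMirror_iff, cornerEdge_mem_cornerMirror_iff, Set.mem_sdiff,
    Set.mem_singleton_iff, not_and, not_not, cornerEdge_injective.eq_iff, cornerEdge_injective.eq_iff,
    Prod.mk.injEq, Prod.mk.injEq]
  constructor
  · intro h
    by_cases h' : cornerEdge (antidiagReflect v w, k) ∈ ω
    · obtain ⟨h3, h4⟩ := h h'
      exact Or.inl ⟨by rw [← h3, antidiagReflect_antidiagReflect], h4⟩
    · exact Or.inr h'
  · rintro (⟨h3, h4⟩ | h) h'
    · exact ⟨by rw [h3, antidiagReflect_antidiagReflect], h4⟩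
    · exact absurd h' h

/-! ## §4 The mirror preserves every `M_t` -/

/-- **Coin-space form of the mirror**: `Ŝ_v (cornerConfig S)` is the corner configuration of the
reflected coins with the COIN complemented and the splitting bit kept, `(c, d)_u ↦ (¬ c, d)_{σ_v u}`. -/
theorem cornerMirror_cornerConfig (v : Site 2) (S : Set (Site 2 × Fin 2)) :
    cornerMirror v (cornerConfig S) =
      cornerConfig (blockMap (fun (g : Fin 2 → Prop) (j : Fin 2) => if j = 0 then ¬ g 0 else g 1)
        (vertexReindex (antidiagEquiv v) S)) := by
  refine eq_of_forall_cornerEdge_mem_iff (cornerMirror_subset_edgeSet v _) (cornerConfig_subset_edgeSet _)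
    fun i => ?_
  obtain ⟨u, j⟩ := i
  rw [cornerEdge_mem_cornerMirror_iff, cornerEdge_mem_cornerConfig_iff, cornerEdge_mem_cornerConfig_iff]
  fin_cases j
  · simp [cornerBit, mem_blockMap_iff, mem_vertexReindex_iff]
  · simp only [Fin.mk_one, Fin.isValue, cornerBit_one, mem_blockMap_iff, mem_vertexReindex_iff,
      antidiagEquiv_apply, ↓reduceIte, one_ne_zero]
    tauto

/-- **The corner mirror preserves `M_t` for every `t`** (vertex reindexing and an involutive block
map fixing the splitting bit both preserve `prodBernoulli (cornerParam t)`). -/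
theorem cornerPercolation_map_cornerMirror :
    ∀ (t : unitInterval) (v : Site 2), (cornerPercolation t).map (cornerMirror v) = cornerPercolation t := by
  intro t v
  refine cornerPercolation_map_eq_of_comm t (measurable_cornerMirror v)
    ((measurable_blockMap _).comp (measurable_vertexReindex _)) ?_ (cornerMirror_cornerConfig v)
  rw [← Measure.map_map (measurable_blockMap _) (measurable_vertexReindex _),
    prodBernoulli_cornerParam_map_vertexReindex,
    prodBernoulli_cornerParam_map_blockMap t flipCoin_involutive flipCoin_one]

/-- Applied form: `M_t {ω | Ŝ_v ω ∈ A} = M_t(A)` for every measurable event `A`. -/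
theorem cornerPercolation_real_preimage_cornerMirror (t : unitInterval) (v : Site 2)
    {A : Set (BondConfig (Site 2))} (hA : MeasurableSet A) :
    (cornerPercolation t).real (cornerMirror v ⁻¹' A) = (cornerPercolation t).real A := by
  rw [measureReal_def, measureReal_def, ← Measure.map_apply (measurable_cornerMirror v) hA,
    cornerPercolation_map_cornerMirror]

/-! ## §5 The mirror event -/

/-- **The mirror event** `A^{Ŝ_v} = {ω | Ŝ_v ω ∉ A}` — for the crude crossing event `A` of `R` this is
"no crude crossing of `R` in the mirrored configuration", the dual-type (hence increasing) event of the
conjugate reflected domain. -/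
def mirrorEvent (v : Site 2) (A : Set (BondConfig (Site 2))) : Set (BondConfig (Site 2)) :=
  {ω | cornerMirror v ω ∉ A}

/-- Membership in the mirror event, unfolded. -/
theorem mem_mirrorEvent_iff (v : Site 2) (A : Set (BondConfig (Site 2))) (ω : BondConfig (Site 2)) :
    ω ∈ mirrorEvent v A ↔ cornerMirror v ω ∉ A :=
  Iff.rfl

/-- The mirror event is the complement of the preimage of `A` under the mirror. -/
theorem mirrorEvent_eq_compl_preimage (v : Site 2) (A : Set (BondConfig (Site 2))) :
    mirrorEvent v A = (cornerMirror v ⁻¹' A)ᶜ :=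
  rfl

/-- **The mirror event of an increasing event is increasing.** -/
theorem isUpperSet_mirrorEvent (v : Site 2) {A : Set (BondConfig (Site 2))} (hA : IsUpperSet A) :
    IsUpperSet (mirrorEvent v A) :=
  fun _ _ h hω hω' => hω (hA (cornerMirror_antitone v h) hω')

/-- The mirror event of a measurable event is measurable. -/
theorem measurableSet_mirrorEvent (v : Site 2) {A : Set (BondConfig (Site 2))} (hA : MeasurableSet A) :
    MeasurableSet (mirrorEvent v A) :=
  (measurable_cornerMirror v hA).compl

/-- `M_t(A^{Ŝ_v}) = 1 − M_t(A)`. -/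
theorem cornerPercolation_real_mirrorEvent (t : unitInterval) (v : Site 2) {A : Set (BondConfig (Site 2))}
    (hA : MeasurableSet A) :
    (cornerPercolation t).real (mirrorEvent v A) = 1 - (cornerPercolation t).real A := by
  rw [mirrorEvent_eq_compl_preimage, measureReal_compl ((measurable_cornerMirror v) hA),
    cornerPercolation_real_preimage_cornerMirror t v hA, probReal_univ]

/-- On lattice configurations the double mirror event is the event: `ω ∈ (A^{Ŝ_v})^{Ŝ_v} ↔ ω ∈ A`. -/
theorem mem_mirrorEvent_mirrorEvent_iff (v : Site 2) (A : Set (BondConfig (Site 2))) {ω : BondConfig (Site 2)}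
    (hω : ω ⊆ (zdGraph 2).edgeSet) : ω ∈ mirrorEvent v (mirrorEvent v A) ↔ ω ∈ A := by
  rw [mem_mirrorEvent_iff, mem_mirrorEvent_iff, not_not, cornerMirror_cornerMirror v hω]

end Summit.CriticalPhenomena.CardyFormulaZ2.Cruxes.UniformMarginality.HeatFlow

end
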